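import Summits.AnomalousDissipation.AnomalousDissipation.Theorems.MomentParityQuarticGateFattenCube
import Summits.AnomalousDissipation.AnomalousDissipation.Theorems.MomentParityQuarticGateLambdaPositivity

/-!
# Order-3 surgery for `MomentParity.QuarticGate` (stmt-AnomalousDissipation-11464), helper I-b:
# FATTENING — a positive definite order-2 moment datum extends to a strictly positive functional

Support file for the stub `stub_order3Surgery` of the line `recession-cone` (S5): the lead's
correction to the order-3 surgery. The order-2 design `μ₀` handed over by S6 is atomic in part, so
its coordinate moment functional is NOT strictly positive (`p = q²` with `q` a quadratic form
vanishing at the atoms has `L(p) = 0`); but only its moments of order `≤ 2` are used downstream,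
and those are the moments of a strictly positive law as soon as the covariance is definite:
`exists_isStrictlyKPositive_eq_of_degree_le_two` — given `y` with `y₀ = 1` and
`L_y((ξ·x)²) > L_y(ξ·x)²` for `ξ ≠ 0`, there is `y₁`, strictly positive in EVERY degree, with
`y₁(α) = y(α)` for `|α| ≤ 2`. Construction: `y₁` = moments of the law of `M + B Z`, `Z` uniform on
the cube `[-1,1]ⁿ` (mean `0`, covariance `I/3`), `M` the mean of `y`, `B Bᵀ = 3Σ` a factor of thrice
the covariance (`CStarAlgebra.nonneg_iff_eq_star_mul_self` on the positive definite matrix `3Σ`);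
strict positivity from `integral_pi_pos` (FattenCube: a nonzero nonnegative polynomial composed
with the affine bijection `z ↦ M + Bz` is analytic, nonnegative and nonzero).
-/

-- `Summit.<Summit>.<Problem>` is the tree's mandated summit-side namespace (CONVENTIONS §2); for this
-- single-conjunct summit the two coincide, so the duplicate is deliberate.
set_option linter.dupNamespace false

namespace Summit.AnomalousDissipation.AnomalousDissipation.Theorems.MomentParityQuarticGate

open scoped BigOperators ENNReal Topology MatrixOrder
open MeasureTheory Set Filter MvPolynomial Literature.MeasureTheory.Moments

/-- `Σᵢ ξᵢ Xᵢ` as a sum of monomials. [folklore] -/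
theorem sum_smul_X_eq_sum_monomial {n : ℕ} (ξ : Fin n → ℝ) :
    (∑ i, ξ i • X i : MvPolynomial (Fin n) ℝ) = ∑ i, monomial (Finsupp.single i 1) (ξ i) :=
  Finset.sum_congr rfl fun i _ => by
    rw [X, smul_monomial, smul_eq_mul, mul_one]

/-- `L_y(Σᵢ ξᵢ Xᵢ) = Σᵢ ξᵢ y(eᵢ)`. [folklore] -/
theorem rieszFunctional_sum_smul_X {n : ℕ} (y : (Fin n →₀ ℕ) → ℝ) (ξ : Fin n → ℝ) :
    rieszFunctional y (∑ i, ξ i • X i) = ∑ i, ξ i * y (Finsupp.single i 1) := by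
  rw [sum_smul_X_eq_sum_monomial, rieszFunctional_finsetSum]
  simp_rw [rieszFunctional_monomial']

/-- `L_y((Σᵢ ξᵢ Xᵢ)²) = Σᵢⱼ ξᵢ ξⱼ y(eᵢ + eⱼ)`. [folklore] -/
theorem rieszFunctional_sum_smul_X_sq {n : ℕ} (y : (Fin n →₀ ℕ) → ℝ) (ξ : Fin n → ℝ) :
    rieszFunctional y ((∑ i, ξ i • X i) ^ 2) =
      ∑ i, ∑ j, ξ i * ξ j * y (Finsupp.single i 1 + Finsupp.single j 1) := by
  rw [sum_smul_X_eq_sum_monomial, sq, Finset.sum_mul_sum, rieszFunctional_finsetSum]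
  refine Finset.sum_congr rfl fun i _ => ?_
  rw [rieszFunctional_finsetSum]
  refine Finset.sum_congr rfl fun j _ => ?_
  rw [monomial_mul, rieszFunctional_monomial']

/-- The monomial `x^{eᵢ}` is the coordinate `xᵢ`. [folklore] -/
theorem prod_pow_single {n : ℕ} (x : Fin n → ℝ) (i : Fin n) :
    ∏ k, x k ^ (Finsupp.single i 1 : Fin n →₀ ℕ) k = x i := by
  classical
  rw [Finset.prod_eq_single i (fun k _ hk => by rw [Finsupp.single_apply, if_neg (Ne.symm hk), pow_zero])
    (fun h => absurd (Finset.mem_univ i) h), Finsupp.single_eq_same, pow_one]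

/-- The monomial `x^{eᵢ+eⱼ}` is `xᵢ xⱼ`. [folklore] -/
theorem prod_pow_single_add_single {n : ℕ} (x : Fin n → ℝ) (i j : Fin n) :
    ∏ k, x k ^ (Finsupp.single i 1 + Finsupp.single j 1 : Fin n →₀ ℕ) k = x i * x j := by
  simp_rw [Finsupp.coe_add, Pi.add_apply, pow_add]
  rw [Finset.prod_mul_distrib, prod_pow_single, prod_pow_single]

/-- **Fattening.** Let `y` be a real multisequence on `ℤ₊ⁿ` with `y₀ = 1` whose order-`≤ 2` block is
positive definite in the sense `L_y((Σ ξᵢXᵢ)²) > L_y(Σ ξᵢXᵢ)²` for `ξ ≠ 0` (definite covariance).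
Then some `y₁` with the SAME entries of degree `≤ 2` has a Riesz functional that is strictly
positive on nonnegative polynomials of every degree on `ℝⁿ` (`y₁` = moments of an affine image of
the uniform cube law with mean and covariance those of `y`). [folklore] -/
theorem exists_isStrictlyKPositive_eq_of_degree_le_two :
    ∀ (n : ℕ) (y : (Fin n →₀ ℕ) → ℝ), y 0 = 1 → (∀ ξ : Fin n → ℝ, ξ ≠ 0 →
      (Literature.MeasureTheory.Moments.rieszFunctional y (∑ i, ξ i • MvPolynomial.X i)) ^ 2 <
      Literature.MeasureTheory.Moments.rieszFunctional y ((∑ i, ξ i • MvPolynomial.X i) ^ 2)) → ∃ y₁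
      : (Fin n →₀ ℕ) → ℝ, (∀ k, Literature.MeasureTheory.Moments.IsStrictlyKPositive (Set.univ : Set
      (Fin n → ℝ)) k y₁) ∧ ∀ α : Fin n →₀ ℕ, α.degree ≤ 2 → y₁ α = y α := by
  intro n y hy0 hpd
  classical
  -- mean `M` and thrice the covariance `C3` of `y`
  set M : Fin n → ℝ := fun i => y (Finsupp.single i 1) with hM
  set C3 : Matrix (Fin n) (Fin n) ℝ := fun i j =>
    3 * (y (Finsupp.single i 1 + Finsupp.single j 1) - M i * M j) with hC3
  have hquad : ∀ ξ : Fin n → ℝ, ξ ⬝ᵥ C3.mulVec ξ =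
      3 * (rieszFunctional y ((∑ i, ξ i • X i) ^ 2) - (rieszFunctional y (∑ i, ξ i • X i)) ^ 2) := by
    intro ξ
    rw [rieszFunctional_sum_smul_X_sq, rieszFunctional_sum_smul_X, sq, Finset.sum_mul_sum,
      ← Finset.sum_sub_distrib, Finset.mul_sum]
    simp only [dotProduct, Matrix.mulVec, hC3, Finset.mul_sum, ← Finset.sum_sub_distrib]
    refine Finset.sum_congr rfl fun i _ => Finset.sum_congr rfl fun j _ => ?_
    ring
  have hherm : C3.IsHermitian := Matrix.IsHermitian.ext fun i j => by
    simp only [hC3, star_trivial]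
    rw [add_comm, mul_comm (M j)]
  have hPD : C3.PosDef := Matrix.PosDef.of_dotProduct_mulVec_pos hherm fun ξ hξ => by
    rw [star_trivial, hquad]
    linarith [hpd ξ hξ]
  -- a factor `B Bᴴ = C3`, `B` invertible
  obtain ⟨A, hA⟩ : ∃ A : Matrix (Fin n) (Fin n) ℝ, C3 = star A * A :=
    CStarAlgebra.nonneg_iff_eq_star_mul_self.mp hPD.posSemidef.nonneg
  obtain ⟨B, hB⟩ : ∃ B : Matrix (Fin n) (Fin n) ℝ, B = star A := ⟨_, rfl⟩
  have hBB : ∀ i j, ∑ k, B i k * B j k = C3 i j := fun i j => by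
    rw [hA, Matrix.mul_apply]
    refine Finset.sum_congr rfl fun k _ => ?_
    simp [hB, Matrix.star_apply]
  have hdetB : IsUnit B.det := by
    rw [isUnit_iff_ne_zero]
    intro h0
    have hpos := hPD.det_pos
    rw [hA, Matrix.det_mul, ← hB, h0, zero_mul] at hpos
    exact lt_irrefl _ hpos
  -- the reference law and its affine image
  obtain ⟨ρ, hρ⟩ : ∃ ρ : Measure ℝ, ρ = (2 : ℝ≥0∞)⁻¹ • (volume.restrict (Set.Icc (-1 : ℝ) 1)) :=
    ⟨_, rfl⟩
  haveI : IsProbabilityMeasure ρ := isProbabilityMeasure_uniformIcc ρ hρ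
  obtain ⟨T, hT⟩ : ∃ T : (Fin n → ℝ) → (Fin n → ℝ), T = fun z => M + B.mulVec z := ⟨_, rfl⟩
  have hTi : ∀ z i, T z i = M i + ∑ k, B i k * z k := fun z i => by
    simp [hT, Matrix.mulVec, dotProduct]
  have hTcont : Continuous T := hT ▸ continuous_const.add (continuous_const.matrix_mulVec continuous_id)
  haveI : IsProbabilityMeasure ((Measure.pi fun _ : Fin n => ρ).map T) :=
    Measure.isProbabilityMeasure_map hTcont.aemeasurable
  have hI : ∀ g : (Fin n → ℝ) → ℝ, Continuous g → Integrable g (Measure.pi fun _ : Fin n => ρ) :=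
    fun g hg => integrable_pi_of_continuous ρ hρ n hg
  have hU : ∀ g : (Fin n → ℝ) → ℝ, Continuous g →
      Integrable g ((Measure.pi fun _ : Fin n => ρ).map T) ∧
      ∫ x, g x ∂((Measure.pi fun _ : Fin n => ρ).map T) = ∫ z, g (T z) ∂(Measure.pi fun _ : Fin n => ρ) :=
    fun g hg => ⟨(integrable_map_measure hg.aestronglyMeasurable hTcont.aemeasurable).mpr
      (hI _ (hg.comp hTcont)), integral_map hTcont.aemeasurable hg.aestronglyMeasurable⟩
  -- first and second moments of the coordinates of `T` under the cube law
  have hS0 : ∀ i, ∫ z, (∑ k, B i k * z k) ∂(Measure.pi fun _ : Fin n => ρ) = 0 := fun i => by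
    rw [integral_finsetSum _ fun k _ => hI _ (by fun_prop)]
    simp_rw [integral_const_mul, integral_coord_pi ρ hρ n, mul_zero, Finset.sum_const_zero]
  have hSS : ∀ i j, ∫ z, (∑ k, B i k * z k) * (∑ l, B j l * z l) ∂(Measure.pi fun _ : Fin n => ρ) =
      3⁻¹ * C3 i j := fun i j => by
    simp_rw [Finset.sum_mul_sum, mul_mul_mul_comm]
    have hinner : ∀ k, ∫ z, ∑ l, B i k * B j l * (z k * z l) ∂(Measure.pi fun _ : Fin n => ρ) =
        ∑ l, B i k * B j l * ∫ z, z k * z l ∂(Measure.pi fun _ : Fin n => ρ) := fun k => by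
      rw [integral_finsetSum _ fun l _ => hI _ (by fun_prop)]
      simp_rw [integral_const_mul]
    rw [integral_finsetSum _ fun k _ => hI _ (by fun_prop)]
    simp_rw [hinner, integral_coord_mul_coord_pi ρ hρ n, mul_ite, mul_zero, Finset.sum_ite_eq,
      Finset.mem_univ, if_true, ← hBB i j, Finset.mul_sum]
    refine Finset.sum_congr rfl fun k _ => ?_
    ring
  have hm1 : ∀ i, ∫ z, T z i ∂(Measure.pi fun _ : Fin n => ρ) = M i := fun i => by
    simp_rw [hTi]
    rw [integral_add (integrable_const _) (hI _ (by fun_prop)), hS0, add_zero]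
    simp
  have hm2 : ∀ i j, ∫ z, T z i * T z j ∂(Measure.pi fun _ : Fin n => ρ) =
      y (Finsupp.single i 1 + Finsupp.single j 1) := fun i j => by
    simp_rw [hTi]
    have e : (fun z : Fin n → ℝ => (M i + ∑ k, B i k * z k) * (M j + ∑ l, B j l * z l)) =
        fun z => M i * M j + ((M i * ∑ l, B j l * z l) + (M j * ∑ k, B i k * z k) +
          (∑ k, B i k * z k) * (∑ l, B j l * z l)) := by
      funext z
      ring
    rw [e, integral_add (integrable_const _) (hI _ (by fun_prop)),
      integral_add (hI _ (by fun_prop)) (hI _ (by fun_prop)),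
      integral_add (hI _ (by fun_prop)) (hI _ (by fun_prop)), integral_const]
    simp only [integral_const_mul, hS0, hSS]
    simp [hC3]
  -- the fattened sequence: moments of the image law
  refine ⟨fun α => ∫ x, ∏ i, x i ^ α i ∂((Measure.pi fun _ : Fin n => ρ).map T), fun k => ?_,
    fun α hα => ?_⟩
  · -- strict positivity in every degree
    refine isStrictlyKPositive_univ_of fun p hp hnn hex => ?_
    have hmono : ∀ α : Fin n →₀ ℕ, Continuous fun x : Fin n → ℝ => ∏ i, x i ^ α i := fun α => by
      fun_prop
    have hR : rieszFunctional (fun α => ∫ x, ∏ i, x i ^ α i ∂((Measure.pi fun _ : Fin n => ρ).map T))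
        p = ∫ x, eval x p ∂((Measure.pi fun _ : Fin n => ρ).map T) := by
      unfold rieszFunctional
      have e : (fun x : Fin n → ℝ => eval x p) =
          fun x => ∑ α ∈ p.support, p.coeff α * ∏ i, x i ^ α i := funext fun x => eval_eq' x p
      rw [e, integral_finsetSum _ fun α _ => ((hU _ (hmono α)).1.const_mul _)]
      simp_rw [integral_const_mul]
    rw [hR, (hU _ (MvPolynomial.continuous_eval p)).2]
    refine integral_pi_pos ρ hρ n (analyticOnNhd_eval_comp p fun i => by
      rw [hT]; exact analyticOnNhd_affine_coord M B i) (fun z => hnn _) ?_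
    obtain ⟨x₀, hx₀⟩ := hex
    refine ⟨B⁻¹.mulVec (x₀ - M), ?_⟩
    have hTx : T (B⁻¹.mulVec (x₀ - M)) = x₀ := by
      simp only [hT]
      rw [Matrix.mulVec_mulVec, Matrix.mul_nonsing_inv _ hdetB, Matrix.one_mulVec, add_sub_cancel]
    rw [hTx]
    exact hx₀
  · -- entries of degree `≤ 2`
    rcases finsupp_degree_le_two α hα with rfl | ⟨i, rfl⟩ | ⟨i, j, rfl⟩
    · simp [hy0]
    · simp_rw [prod_pow_single]
      rw [(hU _ (continuous_apply i)).2, hm1]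
    · simp_rw [prod_pow_single_add_single]
      rw [(hU (fun x => x i * x j) (by fun_prop)).2, hm2]

end Summit.AnomalousDissipation.AnomalousDissipation.Theorems.MomentParityQuarticGate
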